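import Summits.HodgeConjecture.HodgeConjecture.Theorems.Ring2AbelianAllEllipticTimesFourfold
import Summits.HodgeConjecture.HodgeConjecture.Theorems.Ring2AtlasSixfolds
import Summits.HodgeConjecture.HodgeConjecture.Theorems.WeilTypeLadder
import HarnessLib

/-!
# Ring 2 · AbelianAll (seat `ab-weil-2`) — the power cell of `E_k × Y₅`: ONE Weil plane on a six- or EIGHTFOLD as the named price

HONEST FRAMING (sub-cell `pub-hodge-ring2-ab-*`, verbatim): research route, not a corollary; conditional on HC_CM plus
one named minimal statement. (Cell `pub-hodge-ring2`, verbatim: research route conditional on HC_CM; not a corollary;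
Q11.4-sentence-2 already refuted in dim ≥ 3.) `HC_CM` occurs NOWHERE in this file.

THE CELL. `Ring2.Atlas.HodgePowersOfCMEllipticTimesUnitaryFivefold` (atlas-2, `Theorems/Ring2AtlasSixfolds.lean`, p191466): HC for
every power `(E × Y)^{N+1}` (`N ≥ 0`), `E` an elliptic curve with `φ ≫ φ = -d`, `Y` a SIMPLE abelian fivefold with `ψ ≫ ψ = -d`
(`k = ℚ(√-d) ⊂ End⁰(Y)`: type IV(1,1) with `End⁰(Y) = k`, or IV(5,1) CM; `k`-multiplicities on `T₀Y` either `(3,2)` or `(4,1)` up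
to conjugation — `(5,0)` would force `Y ∼ E_k⁵`, not simple). Atlas print status: `(3,2)`: Weil sixfold `E × Y` — `[M]` 1.5.1 /
Schoen / Koike on the hyperbolic component, refereed all powers for `k ∈ {ℚ(i), ℚ(√-3)}` by Abdulali 2012 Thm. 14; `(4,1)`: OPEN,
nothing in print. Certified exceptional dimensions (atlas): `(3,2)`: `X`: 2 (degree 3); `X²`: 24, 64, 88, 98 (degrees 3–6); `X³`: 126
(degree 3); `(4,1)`: `X`, `X²`: `B = D`; `X³`: 42, 210, … (degrees 4, 5).

WHAT THIS FILE PROVES (kernel, 0 sorry). PROPOSITION R5 of `pub-hodge-ring2-ab-weil-2/WEIL-CELLS.md` (DERIVED by this seat: Weyl's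
First Fundamental Theorem + the one-character Hodge group `Hg(E × Y) = ker(u₁^{a} · det_k(u₂))`, `(a, 1)` primitive, itself derived from
Moonen–Zarhin's criterion, `Hg(Y₅) = U_k(V)` resp. `U_F` (Moonen–Zarhin 1999 (2.6)–(2.7), Tankeev–Ribet) and Goursat) says: every rational
`(p,p)`-class on every `(E × Y)^{N+1}` is a polynomial in divisor classes and pull-backs of the ONE Weil plane of the smallest BALANCED
product `P` — for `(3,2)`: `P = Ē × Y` itself, a Weil SIXFOLD; for `(4,1)`: `P = Ē³ × Y`, a Weil EIGHTFOLD — and `P` carries a hyperbolic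
`k`-polarisation (`NS(E_k^{a})_ℚ ≅ Herm_a(k)`, `det` sweeping `ℚ_{>0}`). Its level-one counts reproduce ALL the atlas numbers quoted above
(`(3,2)`: 2; 24/64/88/98 with the level-±2 line `S_{(5,5)}` accounting for `98 = 96 + 2`; 126; `(4,1)`: 42, 210). Typed here as the
HYPOTHESIS `UnitaryFivefoldProductWeilSeeded` (binder `hR5`; ABSOLUTE RULE — never a fact), with the engine of the companion file
(`InDivisorSeedAlgebra`, PROVED there). The NAMED PRICES: hyperbolic Weil SIXFOLDS — `HodgeTheory.Markman2025_weilClasses_algebraic_hyperbolicSixfold`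
(arXiv:2502.03415 Thm. 1.5.1, UNREFEREED; every `k`) — and hyperbolic Weil EIGHTFOLDS — the hweil ladder's rung
`WeilTypeLadder.SplitEightfolds` (route `HeckePrymWeil`/type-II ladder, `Theorems/WeilTypeLadder.lean`; OPEN in all print: Markman's engine is
"special to genus 3"). RESULT: `hodgePowersOfCMEllipticTimesUnitaryFivefold_of_sixfolds_of_eightfolds_of_seeded (h6) (h8) (hR5) :
Ring2.Atlas.HodgePowersOfCMEllipticTimesUnitaryFivefold` — the cell's exact member shape with its two named prices, `HC_CM` ABSENT (also on the
CM members `Y` of type IV(5,1)). This is LEAD's (K)-programme ("a typed member shape with a NAMED price") for this cell; for the `(4,1)` row it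
LOCATES the obstruction at the eightfold rung R2₈ and removes any residual span question (weil-1 T7, "outcome A").

## References
* [MoonenZarhin1999LowDim] Math. Ann. 315 (1999) = arXiv:math/9901113, (2.6)–(2.7), §3 (3.8), §5. [MoonenZarhin1998WeilClasses] Criterion.
* [Markman2025SecantWeil] arXiv:2502.03415 Thm. 1.5.1, §1.2 ("special to genus 3"). [Abdulali2012TateTwistsIV] JPAA 216 (2012) Thm. 14.
* [vanGeemen1994HodgeAV] LNM 1594, 4.9, 5.2–5.4, 6.12. H. Weyl, The Classical Groups (FFT) — docstring proof only.
-/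

set_option linter.dupNamespace false

noncomputable section

open CategoryTheory

namespace Summit.HodgeConjecture.HodgeConjecture.Ring2.AbelianAll

open Literature.AlgebraicGeometry Literature.AlgebraicGeometry.Motives
open Literature.AlgebraicGeometry.HodgeTheory
open Literature.AlgebraicTopology.SingularHomology
open Summit.HodgeConjecture.HodgeConjecture.Theses
open Summit.HodgeConjecture.HodgeConjecture.WeilTypeLadder

/-! ## §1 Weil pull-back seeds in any half-dimension -/

/-- **Weil pull-back seeds of half-dimension `n`** on `B` from a Weil structure `(φ_Z, d)` on a `2n`-fold `Z`: the classes `f^* w ∈ H^{2n}(B(ℂ); ℂ)`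
with `f : B → Z` a homomorphism and `w ∈ weilClassesOf Z φ_Z n d` rational of Hodge type `(n,n)`. (`weilPullbackSeeds` of the companion file is
the case `n = 3`.) [cite: MoonenZarhin1999LowDim, Thm. 0.2 (1)] [cite: vanGeemen1994HodgeAV, 4.9] -/
def weilPullbackSeedsAt (B Z : AbelianVariety ℂ) (φZ : Z ⟶ Z) (n d : ℕ) : Set (complexBetti B.X (2 * n)) :=
  {s | ∃ (f : B ⟶ Z) (w : complexBetti Z.X (2 * n)), IsRationalClass w ∧ IsOfHodgeType (2 * n) Z.X (2 * n) n n w ∧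
      w ∈ weilClassesOf Z φZ n d ∧ s = complexBetti.map f.hom.hom.hom (2 * n) w}

/-- Seeds are algebraic when the rational `(n,n)` Weil classes of `(Z, φ_Z, d)` are (pull-back preserves algebraic classes).
[cite: Fulton1998, App. B.9.2] -/
theorem weilPullbackSeedsAt_subset_algebraicClasses {B Z : AbelianVariety ℂ} {φZ : Z ⟶ Z} {n d : ℕ}
    (hW : ∀ w : complexBetti Z.X (2 * n), IsRationalClass w → IsOfHodgeType (2 * n) Z.X (2 * n) n n w →
      w ∈ weilClassesOf Z φZ n d → w ∈ algebraicClasses Z.X n) :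
    ∀ s ∈ weilPullbackSeedsAt B Z φZ n d, s ∈ algebraicClasses B.X n := by
  rintro s ⟨f, w, hw, hww, hwW, rfl⟩
  exact map_mem_algebraicClasses_of_abelianVariety (AbelianVariety.isSmoothProjective_holds (A := B)) Z f.hom.hom.hom
    (hW w hw hww hwW)

/-! ## §2 The typed hypothesis R5 for `E_k × Y₅` and the cell with its two named prices -/

/-- **TYPED HYPOTHESIS R5 (DERIVED by seat `ab-weil-2`; never a fact).** For every member `(E, Y, φ, ψ, d)` of
`Ring2.Atlas.HodgePowersOfCMEllipticTimesUnitaryFivefold` there are a half-dimension `n ∈ {3, 4}` and a `2n`-fold `Z` with a Weil structure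
`(φ_Z, d)`, hyperbolic for some `k`-symmetrised hyperplane class, such that every rational `(p,p)`-class on every power `(E × Y)^{N+1}` lies in
the divisor–seed algebra of the Weil pull-back seeds of half-dimension `n` from `(Z, φ_Z, d)`. In the derivation (WEIL-CELLS §R5): `k` acts on
`T₀Y` with multiplicities `(3,2)` ⟹ `n = 3`, `Z = E × Y` (the member itself, with the sign of `φ` on `E` chosen so that its eigenvalue on `T₀E` is the
MINORITY eigenvalue of `ψ` on `T₀Y`: `(3,2) + (0,1) = (3,3)`); `(4,1)` ⟹ `n = 4`, `Z = E³ × Y` with the same convention (`(4,1) + (0,3) = (4,4)`); the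
Hodge ring of `(E × Y)^{N+1}` is `ℚ[D¹, f^*W_k(Z)]` by the FFT for `SL(V)` (resp. the CM torus) and the one-character Hodge group
`ker(u₁^{a} det_k u₂)`, `a = 1` resp. `3`; `Z` is hyperbolically polarisable since `det` of a positive hermitian matrix over `k` on `Ē^{a}`
sweeps `ℚ_{>0}`. Level-one counts = atlas: `(3,2)` 2; 24/64/88/98; 126; `(4,1)` 42, 210.
[cite: MoonenZarhin1999LowDim, (2.6)–(2.7) and §3 (3.8)] [cite: vanGeemen1994HodgeAV, Lemma 5.2 and 5.4]
[status: cell proposition (DERIVED, ab-weil-2 R5); refereed SOUND in outline by re-derivation (REFEREE-AB.md R-06: input `Hg(Y₅)` print by prime dimension,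
cocharacter gives `a = 1` / `a = 3`, level-one counts recomputed); a HYPOTHESIS in the kernel] -/
@[conjecture] def UnitaryFivefoldProductWeilSeeded : Prop :=
  ∀ (E Y : AbelianVariety ℂ) (φ : E ⟶ E) (ψ : Y ⟶ Y) (d : ℕ), 0 < d → E.dim = 1 → Y.dim = 5 → Y.IsSimple →
    φ ≫ φ = -(d • 𝟙 E) → ψ ≫ ψ = -(d • 𝟙 Y) →
    ∃ (n : ℕ) (Z : AbelianVariety ℂ) (φZ : Z ⟶ Z) (e : ProjectiveEmbedding Z.X) (a : complexBetti (projectiveSpace e.n ℂ) 2),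
      (n = 3 ∨ n = 4) ∧ Z.dim = 2 * n ∧ φZ ≫ φZ = -(d • 𝟙 Z) ∧ IsRationalClass a ∧ a ≠ 0 ∧
      IsHyperbolicWeilType Z φZ n
        ((d : ℂ) • complexBetti.map e.ι 2 a + complexBetti.map φZ.hom.hom.hom 2 (complexBetti.map e.ι 2 a)) ∧
      ∀ (N p : ℕ) (c : complexBetti ((E.prod Y).powSucc N).X (2 * p)), IsRationalClass c →
        IsOfHodgeType ((E.prod Y).powSucc N).dim ((E.prod Y).powSucc N).X (2 * p) p p c →
        InDivisorSeedAlgebra ((E.prod Y).powSucc N) n (weilPullbackSeedsAt ((E.prod Y).powSucc N) Z φZ n d) p c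

/-- **THE CELL WITH ITS TWO NAMED PRICES (`HC_CM` ABSENT).** `Ring2.Atlas.HodgePowersOfCMEllipticTimesUnitaryFivefold` follows from: (h6) the
Weil classes of every HYPERBOLIC Weil sixfold are algebraic — `Markman2025_weilClasses_algebraic_hyperbolicSixfold` (UNREFEREED); (h8) the same
for hyperbolic Weil EIGHTFOLDS — the hweil rung `WeilTypeLadder.SplitEightfolds` (OPEN in all print; the located obstruction of the `(4,1)` row);
(hR5) the typed member shape R5. [cite: Markman2025SecantWeil, Thm. 1.5.1] [cite: MoonenZarhin1999LowDim, §3 (3.8)] -/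
theorem hodgePowersOfCMEllipticTimesUnitaryFivefold_of_sixfolds_of_eightfolds_of_seeded
    (h6 : Markman2025_weilClasses_algebraic_hyperbolicSixfold) (h8 : SplitEightfolds)
    (hR5 : UnitaryFivefoldProductWeilSeeded) : Ring2.Atlas.HodgePowersOfCMEllipticTimesUnitaryFivefold := by
  intro E Y φ ψ d hd hE hY hYs hφ hψ N
  obtain ⟨n, Z, φZ, e, a, hn, hZ, hφZ, ha, ha0, hyp, hgen⟩ := hR5 E Y φ ψ d hd hE hY hYs hφ hψ
  refine hodgeConjectureFor_of_inDivisorSeedAlgebra (weilPullbackSeedsAt_subset_algebraicClasses ?_) (hgen N)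
  rcases hn with rfl | rfl
  · exact fun w hw hww hwW ↦
      h6 d hd Z φZ hZ (hZ ▸ AbelianVariety.isSmoothProjective_holds (A := Z)) hφZ e a ha ha0 hyp w hw hww hwW
  · exact fun w hw hww hwW ↦
      h8 d hd Z φZ hZ (hZ ▸ AbelianVariety.isSmoothProjective_holds (A := Z)) hφZ e a ha ha0 hyp w hw hww hwW

/-! ON-PATH: `hodgeConjectureFor_powSucc_prod_of_hodgeAbelianVarieties` (companion file) gives every power of `E × Y` under `HC_AV`;
the eightfold price has `WeilTypeLadder.splitEightfolds_of_hodgeConjecture` (hweil), the sixfold price its on-path lemma in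
`WeilClassesSixfolds` — neither binder is stronger than the summit; nothing here is summit progress. -/

end Summit.HodgeConjecture.HodgeConjecture.Ring2.AbelianAll

end
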